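import Summits.CriticalPhenomena.PercolationContinuityZ3.Theorems.Transplant.SkelPhiApronKitAvoid
import Summits.CriticalPhenomena.PercolationContinuityZ3.Theorems.Transplant.SkelPhiKits
import HarnessLib

/-!
# N1 (the `{±1}` node), LEVEL 1, kit adapter file N-K5: **THE KIT CLAUSE OF A WINDOW LEVEL WITH THE APRON KIT** (`Skelφ.kitClauseA`) — the per-level
# clause `hkits` of `KNLevels.TStep.KitsAt` / `Skelφ.WinChainData.kitsAt_stepAF` for a WINDOW MAP `ψ` with quasi-steps of cost `N` over a BASE CHART
# `φ` with unit steps: `∃ σ S, SHyp L j σ ∧ σ.N ≤ N ∧ (1 − q^{sB})^k ≤ δ ∧ S ⊆ B⟨j⟩ ∧ S ⊆ D ∧ seeds off wireSet S ∧ faces ⊆ S ∧ hIV`, with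
# `σ := kitSData … (apronGeomA …)` and `S := pinSetA …` — the N1 twin of `Skelφ.kitClause` (SkelPhiKits §2)

builds on p205010 (kernel theorem, internal audit signed; external expert review pending) — nothing in this file uses p205010; nothing here is a
claim about the open node `SamePDropOfSkeletonNeg`.
Lane `prim-bschramm`, seat `prim-bschramm-p1` (gen 11; design KIT-APRON-N1); helper file (`--supports stmt-CriticalPhenomena-4575 --as helper`).
The per-contact dichotomy of D″ (`hcon`) becomes: FAR contacts — the inner neighbour lies in the target (`hfar`, the rim of the enlarged core, as in
`kitCon_stepIS`); NEAR contacts — a face vertex in the target or the Step-IV estimate of the face `ctFace x` with pinning set `pinSetA` (`hnear`);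
absorbed far contacts use their host's clause.  OUTPUT SHAPE = that of `Skelφ.kitClause` verbatim.
* **`kitClauseA`**.
[cite: KozmaNitzan2024, §4 Lemma 10, Steps III–V (pp. 19–22): "Q ⊆ S"] [cite: GrimmettPercolation1999, §7.2]
-/

noncomputable section

open scoped Classical

namespace Summit.CriticalPhenomena.PercolationContinuityZ3.Theorems.Transplant

namespace Skelφ

open MeasureTheory
open Literature.Probability.Percolation Literature.Probability.LatticeModels SimpleGraph KNLevels
open Literature.Barriers.CriticalPhenomena (graphBall graphBall_finite mem_graphBall_self graphBall_mono)
open Skel (winGraph winGraph_adj winGraph_le KitGeom)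
open SkelI (tanOff tanTgt tanTgt_mem)
open Literature.Probability.Percolation.KozmaNitzan.Cells (oth oth_ne eq_oth_of_ne oth_oth)

variable {V : Type} [DecidableEq V] {G : SimpleGraph V} [G.LocallyFinite] {ψ φ : V → Site 2}

/-- **The kit clause of `KitsAt` / `TargetProperty` for a window level of a window map with quasi-steps over a base chart with unit steps** (the
apron kit): given, per FAR contact, its inner neighbour in the target, and per NEAR contact, a face vertex in the target or the Step-IV estimate of
its face with pinning set `pinSetA`. [cite: KozmaNitzan2024, §4 Lemma 10, Steps III–IV (pp. 19–21)] -/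
theorem kitClauseA [Countable V] {lo hi : Site 2} {j : ℕ} {w₀ : V} {R : ℕ}
    (SF : ∀ (i : Fin 2) (σ : ℤˣ), SideForm ψ φ (lo - (j : Site 2)) (hi + (j : Site 2)) i σ) (Rg : V → Finset V) {P : ApronPrm}
    {Kmax KCmax Rs rs cS cU Δ : ℕ}
    (hlip : Lip G ψ) (hq : QStepsN G ψ P.N) (hstep : Steps G φ) (hΔ : ∀ v, G.degree v ≤ Δ) {q : unitInterval} {δ : ℝ} (hδ : 0 < δ)
    -- the window level and the kit constants
    (hwide : ∀ i, (lo - (j : Site 2)) i + 2 * tanOff P.ℓs P.M ≤ (hi + (j : Site 2)) i)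
    (hdw : ∀ i, (lo - (j : Site 2)) i + (P.d + 2 : ℕ) ≤ (hi + (j : Site 2)) i) (hdD : P.d + 2 ≤ shellD P)
    (hbelow : ∀ (i : Fin 2) (σ : ℤˣ) (z : Site 2), (SF i σ).lin z < (SF i σ).θ (2 + P.d) → ∀ m : ℤ, -(P.W : ℤ) ≤ m → m ≤ P.W →
      (SF i σ).lin (apronPt z (SF i σ).a (SF i σ).s m 0) + P.ℓ * (SF i σ).UL < (SF i σ).θ (shellD P))
    (habove : ∀ (i : Fin 2) (σ : ℤˣ) (z : Site 2), (SF i σ).θ (1 + P.d) ≤ (SF i σ).lin z → ∀ m : ℤ, -(P.W : ℤ) ≤ m → m ≤ P.W →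
      (SF i σ).θ 1 ≤ (SF i σ).lin (apronPt z (SF i σ).a (SF i σ).s m 0) - P.ℓ * (SF i σ).UL)
    (hK : ∀ (i : Fin 2) (σ : ℤˣ) (z : Site 2), (SF i σ).θ (1 + P.d) ≤ (SF i σ).lin z → ∀ m : ℤ, -(P.W : ℤ) ≤ m → m ≤ P.W →
      (SF i σ).apronK z (shellD P) P.ℓ m ≤ Kmax)
    (hKC : ∀ (i : Fin 2) (σ : ℤˣ) (z : Site 2), (SF i σ).θ (1 + P.d) ≤ (SF i σ).lin z → (SF i σ).lin z < (SF i σ).θ (2 + P.d) →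
      (SF i σ).kitK z (shellD P) P.A ≤ KCmax)
    (hcomp : ∀ (v w : V) (n : ℕ), φ v - φ w ∈ box 2 n → ∀ i, |ψ v i - ψ w i| ≤ n + 1)
    (hT : (P.W : ℤ) + Kmax + P.ℓ + 1 ≤ tanOff P.ℓs P.M)
    (hRg : ∀ c, ∀ u ∈ Rg c, u ∈ graphBall G c Rs) (hRgcard : ∀ c, (Rg c).card ≤ cU) (hcU1 : 1 ≤ cU)
    (hr₀ : P.N * (tanOff P.ℓs P.M + 2) + P.N * P.d + (P.W + Kmax + P.R') ≤ P.r₀) (hR : P.r₀ ≤ R)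
    (hrs : 2 * (1 + P.N * (tanOff P.ℓs P.M + 2) + P.N * P.d + (P.W + Kmax + P.R') + (KCmax + Rs)) ≤ rs)
    (hcS : (P.N + 1) * (tanOff P.ℓs P.M + 1) + (P.N + 1) * P.d + (2 * P.W + 1) * (Kmax + 1) * (Δ + 1) ^ P.R' ≤ cS)
    -- the level's source/support, the weighting, the region (containing the level) and the target
    (k : ℕ) (o : V) (Sfin : Finset V) {Wt : Sym2 V → unitInterval} {D T : Finset V}
    (hXD : winLevel G ψ w₀ R lo hi j ⊆ D) {N : ℕ} (hN : k * (Δ + 1) ^ (2 * rs) ≤ N)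
    (hk : (1 - (q : ℝ) ^ (1 + Δ * cS + cS * cU)) ^ k ≤ δ)
    -- per contact: FAR — the inner neighbour in the target; NEAR — a face vertex in the target, or the Step-IV estimate of the face
    (hfar : ∀ x ∈ outerBoundary (winGraph G w₀ R) (winLevel G ψ w₀ R lo hi j), ¬ IsNear G ψ (lo - (j : Site 2)) (hi + (j : Site 2)) P w₀ R x →
      ctY G ψ w₀ R (lo - (j : Site 2)) (hi + (j : Site 2)) x ∈ T)
    (hnear : ∀ x ∈ outerBoundary (winGraph G w₀ R) (winLevel G ψ w₀ R lo hi j), IsNear G ψ (lo - (j : Site 2)) (hi + (j : Site 2)) P w₀ R x →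
      (∃ u ∈ ctFace G SF Rg P w₀ R x, u ∈ T) ∨
      1 - 3 * δ ≤ (prodBernoulli Wt).real {ω | ∃ u ∈ ctFace G SF Rg P w₀ R x,
        1 - δ < (prodBernoulli (pinW Wt (wireSet (↑(pinSetA G SF P w₀ R (outerBoundary (winGraph G w₀ R) (winLevel G ψ w₀ R lo hi j))) : Set V)) ω)).real
          (⋃ t ∈ T, openConnIn (↑D : Set V) u t)}) :
    ∃ (σ : SData V) (S : Finset V), SHyp (winLData G ψ w₀ R lo hi o Sfin) j σ ∧ σ.N ≤ N ∧
      (1 - (q : ℝ) ^ σ.sB) ^ σ.k ≤ δ ∧ S ⊆ (winLData G ψ w₀ R lo hi o Sfin).X j ∧ S ⊆ D ∧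
      (∀ x ∈ σ.K, ∀ e ∈ σ.seed x, e ∉ wireSet (↑S : Set V)) ∧ (∀ x ∈ σ.K, σ.face x ⊆ S) ∧
      (∀ x ∈ σ.K, 1 - 3 * δ ≤ (prodBernoulli Wt).real {ω | ∃ u ∈ σ.face x,
        1 - δ < (prodBernoulli (pinW Wt (wireSet (↑S : Set V)) ω)).real (⋃ t ∈ T, openConnIn (↑D : Set V) u t)}) := by
  set K := outerBoundary (winGraph G w₀ R) (winLevel G ψ w₀ R lo hi j) with hKdef
  set κ := apronGeomA G SF Rg P w₀ R K with hκ
  set Spin := pinSetA G SF P w₀ R K with hSpin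
  have hw2 : ∀ i, (lo - (j : Site 2)) i + 2 ≤ (hi + (j : Site 2)) i := fun i => by have := hwide i; unfold tanOff at this; omega
  have hOK : KitOK G ψ w₀ R lo hi j rs cS cU κ :=
    kitOK_apronA SF Rg hlip hq hstep hΔ hwide hdw hbelow habove hK hKC hcomp hT hRg hRgcard hcU1 hr₀ hR hrs hcS
  have hSX : Spin ⊆ winLevel G ψ w₀ R lo hi j := pinSetA_subset_winLevel SF P
  have hSD : Spin ⊆ D := hSX.trans hXD
  have hface : ∀ x ∈ K, κ.U x ⊆ Spin := fun x hx => face_subset_pinSetA SF Rg P hx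
  refine ⟨kitSData G ψ hΔ w₀ R lo hi j κ rs cS cU k, Spin, shyp_kit hOK hlip o Sfin k, hN, hk, by rw [winLData_X]; exact hSX, hSD,
    fun x hx e he => ?_, fun x hx => ?_, fun x hx => ?_⟩
  · rw [kitSData_K] at hx; rw [kitSData_seed] at he
    exact seed_notMem_wireSet_pinSetA SF Rg hlip hq hstep hw2 hdD hbelow habove hx he
  · rw [kitSData_K] at hx; rw [kitSData_face]; exact hface x hx
  · rw [kitSData_K] at hx
    rw [kitSData_face]
    -- the three kinds of contact
    by_cases hnx : IsNear G ψ (lo - (j : Site 2)) (hi + (j : Site 2)) P w₀ R x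
    · have hUx : κ.U x = ctFace G SF Rg P w₀ R x := by simp only [hκ, apronGeomA, if_pos hnx]
      rw [hUx]
      rcases hnear x hx hnx with ⟨u, hu, huT⟩ | hIV
      · exact hIV_of_mem_face hδ hu huT (hSD (hface x hx (by rw [hUx]; exact hu)))
      · exact hIV
    · by_cases habs : (hosts G SF P w₀ R K x).Nonempty
      · obtain ⟨h0K, h0near, -⟩ := mem_hosts.1 (host_mem habs)
        have hUx : κ.U x = ctFace G SF Rg P w₀ R (host G SF P w₀ R K x) := by simp only [hκ, apronGeomA, if_neg hnx, if_pos habs]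
        have hU0 : κ.U (host G SF P w₀ R K x) = ctFace G SF Rg P w₀ R (host G SF P w₀ R K x) := by
          simp only [hκ, apronGeomA, if_pos h0near]
        rw [hUx]
        rcases hnear _ h0K h0near with ⟨u, hu, huT⟩ | hIV
        · exact hIV_of_mem_face hδ hu huT (hSD (hface _ h0K (by rw [hU0]; exact hu)))
        · exact hIV
      · have hUx : κ.U x = {ctY G ψ w₀ R (lo - (j : Site 2)) (hi + (j : Site 2)) x} := by
          simp only [hκ, apronGeomA, if_neg hnx, if_neg habs]
        rw [hUx]
        exact hIV_of_mem_face hδ (Finset.mem_singleton_self _) (hfar x hx hnx) (hSD (hface x hx (by rw [hUx]; exact Finset.mem_singleton_self _)))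

end Skelφ

end Summit.CriticalPhenomena.PercolationContinuityZ3.Theorems.Transplant

end
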